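import Literature.NumberTheory.Automorphic.UnitarySplitTorusSelfDualVertex                 -- ★ split-torus frame: `exists_formCongr_eq_antidiag_of_not_normOne`, Gram-matrix letters
import Literature.NumberTheory.Rogawski1990.LocalStableClassesNonsplitTypeOneOfCharpoly      -- ★ `exists_eigenframe_of_charpoly_eq_prod`
import Literature.NumberTheory.Rogawski1990.UnitStableOrbitalIntegralIrredOneClass          -- ★ `adelicForm_antidiagTwo_local_hermitian`, `isUnit_det_adelicForm_antidiagTwo_local`
import Literature.NumberTheory.Automorphic.UnitaryGroupBorelInduction                       -- ★ `cmLocalForm`, `conjLocal_conjLocal_cm`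
import Literature.NumberTheory.Automorphic.UnitaryGroupArithmeticLevels                     -- ★ `unitaryGroup_eq_unitaryGroupOfForm`
import HarnessLib

/-!
# R90 · S6 «Ch. 14.1–14.5 stable TF» — «CLASSIFY» FILE C0: the ROOT DICHOTOMY of a regular element of `U(1,1)` and the HYPERBOLIC CELL
# (`Theorems/R90S6GRegularCellsU2Hyp.lean`; T2-ASM census 15fbf54e §2 glue «CLASSIFY», DAG r26 row E1.3.5 ∕ E1.3.6.2)

Cell `hodgecm-mathlib`, crux H413 (`stmt-HodgeConjecture-24833`), route `HCCMUnconditional`; programme R90-TF, section S6 (base `R90-C14`); seat K2E3-p11 (g11)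
(«CLASSIFY» census, R90 bus 2026-09-05T03:30:00Z; dealer R90-C14-plan (g2) 03:03:31Z «CLASSIFY = separate brick»).  Lane `--kind proof --supports
stmt-HodgeConjecture-24833 --as helper`; THEOREMS ONLY (no definition, no instance, no notation, no named fact, no `sorry`).

## The mathematics ([Rogawski1990, §3.6 p. 31; §3.5 Prop. 3.5.2 (c)])
`K` a field with an involution `σ`, `H ∈ M₂(K)` `σ`-hermitian and non-degenerate, `γ ∈ U(σ, H)` with an eigenframe `γ P = P · diag(u₀, u₁)`, `u₀ ≠ u₁` (a REGULAR
semisimple element split over `K`).  The Gram matrix `G = ᵗσ(P) H P` satisfies `G_ij = σ(u_i) G_ij u_j` (★ `twistGram_apply_eq_of_eigenframe`), so: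
* §1 **ROOT DICHOTOMY** `normOne_or_hyperbolic_of_eigenframe`: EITHER both eigenvalues are of norm one (`σ(u_i) u_i = 1`, the anisotropic torus `E¹ × E¹`: the ELL-1
  cell) OR neither is and `σ(u₀) u₁ = 1` (the split torus `diag(a, σ(a)⁻¹)`: the HYP cell) — «the roots of a `σ`-reciprocal quadratic are fixed or swapped by
  `r ↦ σ(r)⁻¹`», proved on the Gram matrix without discriminants.
* §2 **THE HYPERBOLIC CELL IS ONE LITERAL CLASS** `exists_mem_unitaryGroupOfForm_conj_eq_diagonal`: in the HYP case and for the split form `Φ₂ = antidiag(1,1)` ITSELF,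
  the rescaled eigenframe `Q = P D` of ★ `exists_formCongr_eq_antidiag_of_not_normOne` is `Φ₂`-UNITARY (`ᵗσ(Q) Φ₂ Q = Φ₂`) and `Q⁻¹ γ Q = diag(u₀, u₁)`: every
  hyperbolic regular `γ ∈ U(Φ₂)(F_v)` is `U(Φ₂)(F_v)`-conjugate to a LITERAL DIAGONAL element (`H¹(F, Res_{E∕F} 𝔾_m) = 1` in coordinates); twin for the tree's
  `(StdForm.antidiagonal 2).over K` spelling of the (E1)∕(E2) sheets.
* §3 **CM DRESS** `exists_conj_fst_eq_glDiagonal_of_hyperbolic`: for `γ_H = (g, u) ∈ H_v = U(Φ₂)(L⁺_v) × U(Φ₁)(L⁺_v)` at a non-split place with `χ_g = (X − r₀)(X − r₁)`,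
  `r₀ ≠ r₁`, `σ(r₀) r₀ ≠ 1`: some `h ∈ U(Φ₂)(L⁺_v)` has `(h γ_H h⁻¹).1 = glDiagonal 2 d'` — EXACTLY the Levi-stratum letter `hd'` of the ★ hyperbolic payer (B2d) CLOSED
  p864596 (whose identity is a class function of `γ_H`, so the G5 assembler may conjugate first).
NOT here: the ELL-1 ∕ ELL-2 literal cells (files C1 ∕ C2) and the trichotomy head on `IsLocalGRegular` (file C3).
HONEST LABEL: helper algebra, count-neutral; HC_CM is proved only modulo the 7 printed citations (2 remaining named inputs: hLiu418 = stmt-HodgeConjecture-24832,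
h413 = stmt-HodgeConjecture-24833) until rung 0 closes.

## References
* [Rogawski1990] J. D. Rogawski, *Automorphic Representations of Unitary Groups in Three Variables* (1990), §3.5 Prop. 3.5.2 (c) p. 29; §3.6 p. 31; §4.9 p. 55.
* [Serre1980Trees] J.-P. Serre, *Trees* (1980), Ch. II §1.3 (the apartment of the split torus).
* [PlatonovRapinchuk1994] V. Platonov, A. Rapinchuk, *Algebraic Groups and Number Theory* (1994), §2.3, §6.2 (`H¹(F, Res 𝔾_m) = 1`).
-/

set_option autoImplicit false
set_option linter.dupNamespace false  -- the mandated namespace repeats the single-problem summit's segment (`HodgeConjecture.HodgeConjecture`)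

noncomputable section

open Matrix NumberField IsDedekindDomain Polynomial
open Literature.NumberTheory.Automorphic Literature.NumberTheory.Automorphic.UnitaryGroup
open Literature.NumberTheory.Rogawski1990
open Literature.AlgebraicGeometry.ShimuraVarieties (unitaryGroup mem_unitaryGroup_iff unitaryGroup_eq_unitaryGroupOfForm)
open scoped Matrix MatrixGroups

namespace Summit.HodgeConjecture.HodgeConjecture.R90.S6

/-! ## §1 The root dichotomy of a regular element of a rank-two unitary group -/

section Generic

variable {K : Type} [Field K] (σ : K →+* K)

/-- **ROOT DICHOTOMY.**  `σ` an involution of the field `K`, `H ∈ M₂(K)` `σ`-hermitian with `det H ≠ 0`, `γ ∈ U(σ, H)` with an eigenframe `γ P = P · diag(u)`,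
`u₀ ≠ u₁`.  Then EITHER `σ(u₀) u₀ = 1 ∧ σ(u₁) u₁ = 1` (both eigenvalues of norm one: the anisotropic torus `E¹ × E¹`, cell ELL-1) OR `σ(u₀) u₀ ≠ 1 ∧ σ(u₁) u₁ ≠ 1 ∧
σ(u₀) u₁ = 1` (the split torus, cell HYP).  Gram-matrix proof: an eigenvector of non-norm-one eigenvalue is isotropic (★ `twistGram_apply_self_eq_zero_of_ne_one`), a
vanishing diagonal Gram entry forces `G₀₁ ≠ 0` (★ `twistGram_apply_zero_one_ne_zero`), and `G₀₁ ≠ 0` forces `σ(u₀) u₁ = 1` (★ `map_mul_eq_one_of_twistGram_apply_ne_zero`).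
[cite: Rogawski1990, §3.6 p. 31; §3.5 Prop. 3.5.2 (c) p. 29] -/
theorem normOne_or_hyperbolic_of_eigenframe (hσσ : ∀ x, σ (σ x) = x) {H : Matrix (Fin 2) (Fin 2) K} (hH : (H.map σ)ᵀ = H) (hH0 : H.det ≠ 0)
    {γ P : GL (Fin 2) K} {u : Fin 2 → K} (hγ : γ ∈ unitaryGroupOfForm σ H)
    (hP : (γ : Matrix (Fin 2) (Fin 2) K) * P = P * diagonal u) (hu : Function.Injective u) :
    (σ (u 0) * u 0 = 1 ∧ σ (u 1) * u 1 = 1) ∨ (σ (u 0) * u 0 ≠ 1 ∧ σ (u 1) * u 1 ≠ 1 ∧ σ (u 0) * u 1 = 1) := by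
  rw [← unitaryGroup_eq_unitaryGroupOfForm] at hγ
  -- `σ(u₀) u₁ = 1` together with `σ(u_i) u_i = 1` for ONE `i` forces `u₀ = u₁`
  have key : σ (u 0) * u 1 = 1 → σ (u 0) * u 0 = 1 → False := fun h01 h00 => by
    have hσ0 : σ (u 0) ≠ 0 := fun h0 => by rw [h0, zero_mul] at h00; exact zero_ne_one h00
    exact absurd (hu (mul_left_cancel₀ hσ0 (h00.trans h01.symm))) zero_ne_one
  have key' : σ (u 0) * u 1 = 1 → σ (u 1) * u 1 = 1 → False := fun h01 h11 => by
    have hu1 : u 1 ≠ 0 := fun h0 => by rw [h0, mul_zero] at h11; exact zero_ne_one h11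
    have hσ : σ (u 0) = σ (u 1) := mul_right_cancel₀ hu1 (h01.trans h11.symm)
    have h01' : u 0 = u 1 := by rw [← hσσ (u 0), hσ, hσσ]
    exact absurd (hu h01') zero_ne_one
  by_cases h0 : σ (u 0) * u 0 = 1
  · by_cases h1 : σ (u 1) * u 1 = 1
    · exact Or.inl ⟨h0, h1⟩
    · -- `G₁₁ = 0 ⇒ G₀₁ ≠ 0 ⇒ σ(u₀) u₁ = 1`, contradicting `h0`
      have h11 := twistGram_apply_self_eq_zero_of_ne_one σ hγ hP h1
      have h01 := map_mul_eq_one_of_twistGram_apply_ne_zero σ hγ hP (twistGram_apply_zero_one_ne_zero σ hσσ hH hH0 P (Or.inr h11))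
      exact (key h01 h0).elim
  · have h00 := twistGram_apply_self_eq_zero_of_ne_one σ hγ hP h0
    have h01 := map_mul_eq_one_of_twistGram_apply_ne_zero σ hγ hP (twistGram_apply_zero_one_ne_zero σ hσσ hH hH0 P (Or.inl h00))
    exact Or.inr ⟨h0, fun h1 => key' h01 h1, h01⟩

/-! ## §2 The hyperbolic cell: conjugate IN `U(Φ₂)` to a literal diagonal element -/

/-- **THE HYPERBOLIC CELL IS A LITERAL DIAGONAL CLASS** (split form `Φ₂ = antidiag(1,1)` literal).  `σ` an involution of `K`, `γ ∈ U(σ, Φ₂)` with an eigenframe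
`γ P = P · diag(u)`, `u₀ ≠ u₁`, `σ(u₀) u₀ ≠ 1`.  Then some `Q ∈ U(σ, Φ₂)` has `Q⁻¹ γ Q = diag(u₀, u₁)` as matrices: the rescaled eigenframe `Q = P D` of ★
`exists_formCongr_eq_antidiag_of_not_normOne` has Gram matrix `Φ₂` itself, i.e. IS `Φ₂`-unitary, and diagonal matrices commute (★ `inv_mul_mul_eq_diagonal_of_eigenframe`).
[cite: Rogawski1990, §3.6 p. 31] [cite: Serre1980Trees, Ch. II §1.3] [cite: PlatonovRapinchuk1994, §2.3] -/
theorem exists_mem_unitaryGroupOfForm_conj_eq_diagonal (hσσ : ∀ x, σ (σ x) = x) {γ P : GL (Fin 2) K} {u : Fin 2 → K}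
    (hγ : γ ∈ unitaryGroupOfForm σ (Matrix.of fun i j : Fin 2 => if i.val + j.val + 1 = 2 then (1 : K) else 0))
    (hP : (γ : Matrix (Fin 2) (Fin 2) K) * P = P * diagonal u) (hu : Function.Injective u) (hN : σ (u 0) * u 0 ≠ 1) :
    ∃ Q : GL (Fin 2) K, Q ∈ unitaryGroupOfForm σ (Matrix.of fun i j : Fin 2 => if i.val + j.val + 1 = 2 then (1 : K) else 0) ∧
      ((Q⁻¹ * γ * Q : GL (Fin 2) K) : Matrix (Fin 2) (Fin 2) K) = diagonal u := by
  have hH : ((Matrix.of fun i j : Fin 2 => if i.val + j.val + 1 = 2 then (1 : K) else 0).map σ)ᵀ =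
      Matrix.of fun i j : Fin 2 => if i.val + j.val + 1 = 2 then (1 : K) else 0 := by
    ext i j
    fin_cases i <;> fin_cases j <;> simp
  have hH0 : (Matrix.of fun i j : Fin 2 => if i.val + j.val + 1 = 2 then (1 : K) else 0).det ≠ 0 := by
    rw [Matrix.det_fin_two]
    simp
  have hγ' := hγ
  rw [← unitaryGroup_eq_unitaryGroupOfForm] at hγ'
  obtain ⟨D, c, hD, hQ⟩ := exists_formCongr_eq_antidiag_of_not_normOne σ hσσ hH hH0 hγ' hP hu hN
  exact ⟨P * D, mem_unitaryGroupOfForm_iff.2 hQ, inv_mul_mul_eq_diagonal_of_eigenframe γ P D hP hD⟩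

/-- The same in the currency of the (E1)∕(E2) sheets and the one-place frames, `U₂ = unitaryGroupOfForm σ ((StdForm.antidiagonal 2).over K)` (★ `antidiagOne_eq_over`),
stated on ELEMENTS of `U₂`: `∃ h ∈ U₂, h γ h⁻¹ = diag(u₀, u₁)`. [cite: Rogawski1990, §3.6 p. 31] [cite: Serre1980Trees, Ch. II §1.3] -/
theorem exists_conj_coe_eq_diagonal_of_not_normOne (hσσ : ∀ x, σ (σ x) = x) (γ : ↥(unitaryGroupOfForm σ ((StdForm.antidiagonal 2).over K)))
    {P : GL (Fin 2) K} {u : Fin 2 → K} (hP : ((γ : GL (Fin 2) K) : Matrix (Fin 2) (Fin 2) K) * P = P * diagonal u) (hu : Function.Injective u)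
    (hN : σ (u 0) * u 0 ≠ 1) :
    ∃ h : ↥(unitaryGroupOfForm σ ((StdForm.antidiagonal 2).over K)), (((h * γ * h⁻¹ : ↥(unitaryGroupOfForm σ ((StdForm.antidiagonal 2).over K))) :
      GL (Fin 2) K) : Matrix (Fin 2) (Fin 2) K) = diagonal u := by
  have hγ : (γ : GL (Fin 2) K) ∈ unitaryGroupOfForm σ (Matrix.of fun i j : Fin 2 => if i.val + j.val + 1 = 2 then (1 : K) else 0) := by
    rw [antidiagOne_eq_over]; exact γ.2
  obtain ⟨Q, hQ, hQγ⟩ := exists_mem_unitaryGroupOfForm_conj_eq_diagonal σ hσσ hγ hP hu hN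
  rw [antidiagOne_eq_over] at hQ
  refine ⟨⟨Q, hQ⟩⁻¹, ?_⟩
  rw [inv_inv]
  exact hQγ

end Generic

/-! ## §3 CM dress: the Levi-stratum letter `hd'` of the ★ hyperbolic payer, for every hyperbolic regular `γ_H ∈ H_v` -/

section CM

variable (L : Type) [Field L] [NumberField L] [IsCMField L] (v : HeightOneSpectrum (𝓞 ↥(maximalRealSubfield L)))

/-- **CM DRESS OF THE HYPERBOLIC CELL.**  At a finite place `v` of `L⁺` non-split in the CM field `L` (`c • w = w`), let `γ_H = (g, u) ∈ H_v = U(Φ₂)(L⁺_v) × U(Φ₁)(L⁺_v)`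
with `χ_g = (X − r₀)(X − r₁)` over `L ⊗ L⁺_v` (`= L_w`, a field), `r₀ ≠ r₁` and `r₀` NOT of norm one (`σ(r₀) r₀ ≠ 1`).  Then some `h ∈ U(Φ₂)(L⁺_v)` conjugates `γ_H` onto
the Levi stratum LITERALLY: `glDiagonal 2 d' = ((h, 1) γ_H (h, 1)⁻¹).1` with `d' = (r₀, r₁)` — the letter `hd'` of ★ (B2d) CLOSED
`stableOrbitalIntegralRel_coeff_toVector_eq_finsum_finExplicitDelta_of_levi_of_frames` (whose identity is a class function of `γ_H` on both sides, so the G5 assembler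
conjugates first).  §1 + §2 at `K := L ⊗ L⁺_v` (★ `LocalRing.isField_of_smul_eq`), `σ := c ⊗ 1` (★ `conjLocal_conjLocal_cm`), `H := (Φ₂)_v` (★
`adelicForm_antidiagTwo_local_hermitian`, ★ `isUnit_det_adelicForm_antidiagTwo_local`). [cite: Rogawski1990, §3.6 p. 31; §4.9 p. 55] [cite: PlatonovRapinchuk1994, §2.3] -/
theorem exists_conj_fst_eq_glDiagonal_of_hyperbolic (w : PlacesOver L v) (hw : IsCMField.complexConj L • w.1 = w.1)
    (γH : (cmDatum L 2 (Matrix.of fun i j : Fin 2 => if i.val + j.val + 1 = 2 then (1 : L) else 0)).Local v ×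
      (cmDatum L 1 (Matrix.of fun i j : Fin 1 => if i.val + j.val + 1 = 1 then (1 : L) else 0)).Local v)
    {r : Fin 2 → LocalRing L v} (hχ : (γH.1.val : Matrix (Fin 2) (Fin 2) (LocalRing L v)).charpoly = ∏ i, (X - C (r i)))
    (hr : Function.Injective r) (hN : conjLocal L (IsCMField.complexConj L) v (r 0) * r 0 ≠ 1) :
    ∃ (h : (cmDatum L 2 (Matrix.of fun i j : Fin 2 => if i.val + j.val + 1 = 2 then (1 : L) else 0)).Local v)
      (d' : Fin 2 → (LocalRing L v)ˣ), (∀ i, (d' i : LocalRing L v) = r i) ∧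
        glDiagonal 2 (LocalRing L v) d' = ((h * γH.1 * h⁻¹ :
          (cmDatum L 2 (Matrix.of fun i j : Fin 2 => if i.val + j.val + 1 = 2 then (1 : L) else 0)).Local v).val : GL (Fin 2) (LocalRing L v)) := by
  haveI : Algebra.IsQuadraticExtension ↥(maximalRealSubfield L) L := IsCMField.isQuadraticExtension L
  letI : Field (LocalRing L v) :=
    (LocalRing.isField_of_smul_eq (IsCMField.complexConj L) (IsCMField.complexConj_ne_one L) w hw).toField
  have hσσ := conjLocal_conjLocal_cm L v
  -- `(Φ₂)_v` is the literal `antidiag(1,1)` over `L ⊗ L⁺_v`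
  have hΦ : cmLocalForm L 2 v = Matrix.of fun i j : Fin 2 => if i.val + j.val + 1 = 2 then (1 : LocalRing L v) else 0 := by
    rw [cmLocalForm, UnitaryGroup.adelicForm_map_adeleToLocal]
    ext i j
    simp only [Matrix.map_apply, Matrix.of_apply]
    split_ifs <;> simp
  -- the eigenframe
  obtain ⟨P, hP⟩ := exists_eigenframe_of_charpoly_eq_prod γH.1.val r hr hχ
  have hγ : (γH.1.val : GL (Fin 2) (LocalRing L v)) ∈
      unitaryGroupOfForm (conjLocal L (IsCMField.complexConj L) v) (Matrix.of fun i j : Fin 2 => if i.val + j.val + 1 = 2 then (1 : LocalRing L v) else 0) := by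
    rw [← hΦ]; exact γH.1.2
  obtain ⟨Q, hQ, hQγ⟩ := exists_mem_unitaryGroupOfForm_conj_eq_diagonal (conjLocal L (IsCMField.complexConj L) v) hσσ hγ hP hr hN
  rw [← hΦ] at hQ
  -- the eigenvalues are units (`det γ = r₀ r₁ ≠ 0`)
  have hdet : (γH.1.val : Matrix (Fin 2) (Fin 2) (LocalRing L v)).det = r 0 * r 1 := det_eq_mul_of_mul_eigenframe_two P hP
  have hr0 : ∀ i, r i ≠ 0 := by
    have hd : r 0 * r 1 ≠ 0 := by
      rw [← hdet]; exact ((Matrix.isUnit_iff_isUnit_det _).1 (γH.1.val).isUnit).ne_zero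
    intro i
    fin_cases i
    · exact left_ne_zero_of_mul hd
    · exact right_ne_zero_of_mul hd
  refine ⟨⟨Q, hQ⟩⁻¹, fun i => Units.mk0 (r i) (hr0 i), fun i => rfl, Units.ext ?_⟩
  rw [coe_glDiagonal]
  change diagonal r = (((⟨Q, hQ⟩⁻¹ * γH.1 * (⟨Q, hQ⟩⁻¹)⁻¹ :
      (cmDatum L 2 (Matrix.of fun i j : Fin 2 => if i.val + j.val + 1 = 2 then (1 : L) else 0)).Local v).val : GL (Fin 2) (LocalRing L v)) :
        Matrix (Fin 2) (Fin 2) (LocalRing L v))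
  rw [inv_inv]
  exact hQγ.symm

end CM

end Summit.HodgeConjecture.HodgeConjecture.R90.S6

end
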